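import Summits.BirchSwinnertonDyer.BirchSwinnertonDyer.Theorems.SprungSharpFlatMainConjectureEdges
import Summits.BirchSwinnertonDyer.BirchSwinnertonDyer.Theorems.SignedLowerHalvesSprungLowerHalfAtThreeChromaticReduction
import Summits.BirchSwinnertonDyer.Rank1Residual.Supersingular.SqueezeCertificates
import Literature.NumberTheory.EllipticCurves.Sprung2024.ChromaticSmallControl
import Literature.NumberTheory.EllipticCurves.Sprung2012.SharpFlatKatoDivisibility
import Literature.NumberTheory.EllipticCurves.LeadingTermPPartProofs
import Literature.NumberTheory.EllipticCurves.CuspFormLFunctionLevelConductorProofs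
import HarnessLib

/-!
# Route `SignedLowerHalves`, crux child K1 `SprungLowerDivisibilityAtThree` (item
# stmt-BirchSwinnertonDyer-19875) OFF the assembly's branch, at ANALYTIC RANK ONE: Sprung's ♯/♭ Main
# Conjecture 7.21 on the REAL `X^•(E/ℚ_∞)` per pair from a `(μ, λ)(L^•) = (0, 1)` certificate, the
# control input DISCHARGED BY NAME (cell `bsd-ssimc`, seat `bsd-ssimc-k3-c5` g9, object «K1-R1-REAL»;
# `--supports … --as helper`)

PARTITION (cell bsd-ssimc): X8 (A8) ∩ {r_an = 1} ∩ Surj(3), `p = 3` (75 A8 cells; the part of K1's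
open surplus with positive analytic rank — `K1Branch.sprungLowerDivisibilityAtThree_iff_bsdp_branch_and_offBranch`);
types-the-object-of (K1 witnesses at rank one in Sprung's real currency); closes NONE; 0 census moves;
BSD is not proved by any of this.

## What this file proves

The tree's rank-one ♯/♭ squeeze (b2b, `Supersingular/SignedSqueeze.lean` p208039 /
`SqueezeCertificates.lean`: `X8.charIdealEq_of_lam_eq_one_of_analyticRank_eq_one`,
`X8.span_eq_span_sharp/flat_of_mazurTate_of_analyticRank_eq_one`) works on an ABSTRACT datum `ξ` and
DISPLAYS two Selmer-side binders: the control `hC : T^{rank E(ℚ)} ∣ ξ` and Kato's `hKato : ξ ∣ L^•`.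
On Sprung's REAL `X^•(E/ℚ_∞)` (`Sprung2012.SharpFlatSelmerDualData`, kdot-split g2) both are now NAMED
PUBLISHED facts: `hKato` is Sprung 2012 Thm. 7.16 (`thm716_…`, `n = 0` under `3`-adic surjectivity =
Wuthrich 2014 Lemma 20 + Surj(3) at the good prime `3`), and `hC` follows from the SURJECTIVITY half of
Sprung 2024 Lemma 5.6 (Small Control Theorem) in corollary form
(`Sprung2024.lem56AllN_sharpFlat_finite_selmer_of_finite_coinvariants`, this seat's APPEND to
`Sprung2024/ChromaticSmallControl.lean`: `X^•/TX^•` finite ⟹ `Sel_{3^∞}(E/ℚ)` finite) together with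
GZK (`rank E(ℚ) = 1` ⇒ `Sel_{3^∞}(E/ℚ)` infinite, tree theorem) and Greenberg's Lemma 4.2 (tree theorem
`IwasawaAlgebra.finite_coinvariants_of_constantCoeff_ne_zero`: `gen(0) ≠ 0` ⇒ `X^•/TX^•` finite), whence
`gen(0) = 0`, i.e. `T ∣ gen`. Hence:

* `sprungSharpFlatMainConjecture_of_lam_eq_one_of_analyticRank_eq_one` — on X8 ∧ Surj(3) ∧
  `r_an = 1`, for a colour `•` with the two-engine certificate `(μ, λ)(L^•_3(E)) = (0, 1)` (for every
  newform of `W` and its Sprung pair — unique, Sprung 2017 Thm. 1.12): `Theorems.SprungSharpFlatMainConjecture W 3 •`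
  on the REAL `X^•`, modulo `thm714`, `thm716`, the new control fact, the period unit at `3`, Wuthrich
  L20, GZK; corollary `sprungSharpFlatLowerDivisibility_of_lam_eq_one_…` = K1's predicate at the pair.
  Per pair; the certificate is displayed (`hcert`), as in b2b's
  `X7.kobayashiMainConjecture_of_lam_eq_one_of_analyticRank_eq_one` (the `a_p = 0` twin, where the control
  is the tree theorem `SignedSelmerDualData.X_pow_mordellWeilRank_dvd_of_charIdeal_eq_span`; for ♯/♭
  no description of `Sel^•` by points is known — Sprung 2012 Open Problem 7.22 — so the control is a
  named fact).

HONEST STATUS: CONDITIONAL on the displayed named facts (published; the all-N forms of Lemma 5.6 carry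
the flag `Sprung24-§5.2-L5.6-allN-via-RaySprung25`) and on the per-pair certificate; closes nothing;
K1 stays OPEN class-wide. Not a new engine; BSD is not proved by any of this.

References: [Sprung2012] Thm. 7.14, Thm. 7.16, Main Conj. 7.21, Open Problem 7.22 (pp. 1504–1505);
[Sprung2024] §5.2 Lemma 5.6 (p. 41); [GreenbergLNM1716] §4 Lemma 4.2 (p. 103); [GreenbergVatsal2000]
p. 4; [Wuthrich2014] Lemma 20; [Sprung2017] Thm. 1.12.
-/

set_option autoImplicit false
-- justification: the mandated namespace `Summit.BirchSwinnertonDyer.BirchSwinnertonDyer.Theorems`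
-- (single-conjunct summit, Sub = Summit) repeats a segment by design (D-0017).
set_option linter.dupNamespace false

noncomputable section


namespace Summit.BirchSwinnertonDyer.BirchSwinnertonDyer.Theorems.K1RankOne

open scoped Classical NumberField MatrixGroups ModularForm
open NumberField IsDedekindDomain WeierstrassCurve CongruenceSubgroup
  Literature.NumberTheory.EllipticCurves Literature.NumberTheory.EllipticCurves.ModularForms
  Literature.NumberTheory.EllipticCurves.Rank1Residual
  Literature.NumberTheory.EllipticCurves.Rank1Residual.Typed
  Literature.NumberTheory.EllipticCurves.Sprung2017 Literature.NumberTheory.EllipticCurves.Sprung2012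
  Literature.NumberTheory.EllipticCurves.Sprung2024
  Literature.NumberTheory.EllipticCurves.ZpExtension
  Summit.BirchSwinnertonDyer.Rank1Residual.X1.MuLambda
  Summit.BirchSwinnertonDyer.Rank1Residual.Supersingular
  Summit.BirchSwinnertonDyer.BirchSwinnertonDyer.Theorems

/-- **X8 ∧ Surj(3) ∧ `r_an = 1`: Sprung's ♯/♭ Main Conjecture 7.21 at the pair, for the colour `•`
carrying the certificate `(μ, λ)(L^•_3(E)) = (0, 1)`, on the REAL `X^•(E/ℚ_∞)`.** Named inputs
(published): Sprung 2012 Thm. 7.14 (`h714`), Thm. 7.16 (`h716`, Kato's `gen ∣ L^•`, `n = 0` by Wuthrich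
2014 Lemma 20 `hL20` + Surj(3)), the SURJECTIVITY half of Sprung 2024 Lemma 5.6 at all levels
(`hctrl` = `lem56AllN_sharpFlat_finite_selmer_of_finite_coinvariants`), the period unit at `3` (`h3`),
GZK. Displayed per pair: the class, Surj(3), `r_an = 1`, and `hcert` (for every newform `f` of `W` and
every Sprung pair — unique by Sprung 2017 Thm. 1.12 — `μ(L^•) = 0` and `λ(L^•) = 1`; certified by two
engines on the cell's Mazur–Tate rows). Proof: generator `gen` of `char_Λ(X^•)` (Λ a UFD; `X^•` torsion by
Thm. 7.14); CONTROL: `rank E(ℚ) = 1` (GZK) ⇒ `Sel_{3^∞}(E/ℚ)` infinite ⇒ (`hctrl`) `X^•/TX^•` infinite ⇒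
(Greenberg L4.2, `finite_coinvariants_of_constantCoeff_ne_zero`) `gen(0) = 0`, i.e. `T ∣ gen`; KATO:
`gen ∣ L^•`; SQUEEZE: `span_eq_span_of_dvd_of_X_dvd_of_lam_eq_one` ⇒ `(gen) = (L^•)`; `ϖ ∈ ℤ₃^×`
(`X8_norm_periodRatio_eq_one`). PER PAIR; closes nothing; K1 stays OPEN class-wide.
[cite: Sprung2012, Thm. 7.14, Thm. 7.16 and Main Conj. 7.21 (pp. 1504–1505)]
[cite: Sprung2024, §5.2 Lemma 5.6 (p. 41)] [cite: GreenbergLNM1716, §4 Lemma 4.2 (p. 103)]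
[cite: GreenbergVatsal2000, p. 4] [cite: Wuthrich2014, Lemma 20 (p. 399)] -/
theorem sprungSharpFlatMainConjecture_of_lam_eq_one_of_analyticRank_eq_one
    (h714 : thm714_sharpFlatSelmerDual_finite_torsion)
    (h716 : thm716_sharpFlatCharIdeal_divisibility)
    (hctrl : lem56AllN_sharpFlat_finite_selmer_of_finite_coinvariants)
    (h3 : realPeriodRat_eq_unit_mul_plusPeriod_three)
    (hL20 : Wuthrich2014.lemma20_surjective_threeAdic_of_semistable)
    (hGZK : rank_eq_analyticRank_of_analyticRank_le_one)
    (W : WeierstrassCurve ℚ) [W.IsElliptic] [W.IsGloballyMinimal] (p : ℕ) [Fact p.Prime]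
    (hX : ClassX8 W p) (hs : Surj W p) (h1 : W.analyticRank = 1) (col : Chroma)
    (hcert : ∀ {N : ℕ} [NeZero N] (f : CuspForm (Gamma0 N) 2), IsNewformOf W f →
      ∀ Lsharp Lflat : IwasawaAlgebra p, IsSprungPair f p (W.frobeniusTrace p) Lsharp Lflat →
        mu (chromaticL col Lsharp Lflat) = 0 ∧ lam (chromaticL col Lsharp Lflat) = 1) :
    SprungSharpFlatMainConjecture W p col := by
  intro κ γ hκ hγ hγ' v hv g hg cneg c hc N hN f ϖ Lsharp Lflat hf hϖ hSP hcol D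
  haveI := hN
  have hp3 : p = 3 := hX.1
  subst hp3
  have hp2 : (3 : ℕ) ≠ 2 := by decide
  have hgood : W.HasGoodReductionAtPrime 3 := hX.2.1.1
  have hdvd : ((3 : ℕ) : ℤ) ∣ W.frobeniusTrace 3 := hX.2.1.2
  -- Sprung 2012 Thm. 7.14: `X^•` finitely generated and `Λ`-torsion
  obtain ⟨hfinD, htorD⟩ :=
    h714 W 3 hp2 hgood hdvd f hf κ γ hκ hγ hγ' v hv g hg cneg c hc col Lsharp Lflat hSP hcol D
  haveI := hfinD
  -- a generator of `char_Λ(X^•)` (`Λ` is a UFD)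
  obtain ⟨gen, hgen⟩ := (charIdeal_isPrincipal_holds 3 D.X).principal
  have hchar : D.charIdeal = Ideal.span {gen} := hgen
  -- CONTROL: `rank E(ℚ) = 1` ⇒ `Sel_{3^∞}(E/ℚ)` infinite ⇒ `X^•/TX^•` infinite ⇒ `gen(0) = 0`
  have hrank : W.mordellWeilRank = 1 := (hGZK W (by omega)).1.trans h1
  have hSel : ¬ Finite (W.selmerGroupPInfty 3) := by
    intro hfin
    haveI := hfin
    haveI : Finite W.toAffine.Point := W.finite_point_of_finite_selmerGroupPInfty 3
    have h0 : W.mordellWeilRank = 0 := W.mordellWeilRank_eq_zero_iff_finite.mpr ‹_›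
    omega
  have hgen0 : PowerSeries.constantCoeff gen = 0 := by
    by_contra h0
    refine hSel (hctrl W 3 hp2 hgood hdvd κ γ hκ hγ hγ' v hv g hg cneg c hc col D ?_)
    exact IwasawaAlgebra.finite_coinvariants_of_constantCoeff_ne_zero 3 D.X htorD gen
      (by rw [show Module.charIdeal (IwasawaAlgebra 3) D.X = D.charIdeal from rfl, hchar]
          exact Ideal.mem_span_singleton_self gen) h0
  have hXdvd : (PowerSeries.X : IwasawaAlgebra 3) ∣ gen := PowerSeries.X_dvd_iff.mpr hgen0
  -- KATO (`n = 0` under `3`-adic surjectivity): `gen ∣ L^•`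
  have hsurj : ∀ n : ℕ, W.HasSurjectiveModNGaloisRep (3 ^ n : ℕ) :=
    surjective_pow_of_surj_of_good W 3 hL20 hp2 hgood hs
  have hKato : gen ∣ chromaticL col Lsharp Lflat :=
    h716.dvd_of_charIdeal_eq_span hp2 hgood hdvd hf hκ hγ hγ' hv hg hc hSP hcol D htorD hsurj hchar
  -- SQUEEZE with the certificate `(μ, λ)(L^•) = (0, 1)`
  obtain ⟨hμ, hlam⟩ := hcert f hf Lsharp Lflat hSP
  have hspan : Ideal.span ({gen} : Set (IwasawaAlgebra 3)) =
      Ideal.span {chromaticL col Lsharp Lflat} :=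
    span_eq_span_of_dvd_of_X_dvd_of_lam_eq_one hKato hXdvd hμ hlam
  -- `ϖ` is a `3`-adic unit on X8
  have hϖ1 : ‖(ϖ : ℚ_[3])‖ = 1 := X8_norm_periodRatio_eq_one h3 W 3 hX hf hϖ
  obtain ⟨hspan', hι⟩ := span_C_units_mul_eq (PadicInt.mkUnits hϖ1) (chromaticL col Lsharp Lflat)
  refine ⟨htorD, PowerSeries.C ((PadicInt.mkUnits hϖ1 : ℤ_[3]ˣ) : ℤ_[3]) *
    chromaticL col Lsharp Lflat, ?_, ?_⟩
  · rw [hchar, hspan, hspan']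
  · rw [hι, PadicInt.mkUnits_eq]

/-- **The same on X8 ∩ {square-free `N`} from the PRINTED scope of Lemma 5.6** (named fact
`lem56_sharpFlat_finite_selmer_of_finite_coinvariants`, §5.2's standing binder `W.IsSemistable (𝓞 ℚ)`
kept; NO all-N flag): for a semistable X8 pair with Surj(3) (automatic for semistable X8, Serre; kept
displayed to avoid a second semistability predicate), `r_an = 1` and the certificate, Sprung's Main
Conjecture 7.21 at the pair on the REAL `X^•`. PER PAIR; closes nothing.
[cite: Sprung2012, Thm. 7.16 and Main Conj. 7.21 (pp. 1504–1505)] [cite: Sprung2024, §5.2 Lemma 5.6 (p. 41)]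
[cite: GreenbergLNM1716, §4 Lemma 4.2 (p. 103)] [cite: GreenbergVatsal2000, p. 4] -/
theorem sprungSharpFlatMainConjecture_of_lam_eq_one_of_isSemistable_of_analyticRank_eq_one
    (h714 : thm714_sharpFlatSelmerDual_finite_torsion)
    (h716 : thm716_sharpFlatCharIdeal_divisibility)
    (hctrl : lem56_sharpFlat_finite_selmer_of_finite_coinvariants)
    (h3 : realPeriodRat_eq_unit_mul_plusPeriod_three)
    (hL20 : Wuthrich2014.lemma20_surjective_threeAdic_of_semistable)
    (hGZK : rank_eq_analyticRank_of_analyticRank_le_one)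
    (W : WeierstrassCurve ℚ) [W.IsElliptic] [W.IsGloballyMinimal] (p : ℕ) [Fact p.Prime]
    (hX : ClassX8 W p) (hsst : W.IsSemistable (𝓞 ℚ)) (hs : Surj W p) (h1 : W.analyticRank = 1)
    (col : Chroma)
    (hcert : ∀ {N : ℕ} [NeZero N] (f : CuspForm (Gamma0 N) 2), IsNewformOf W f →
      ∀ Lsharp Lflat : IwasawaAlgebra p, IsSprungPair f p (W.frobeniusTrace p) Lsharp Lflat →
        mu (chromaticL col Lsharp Lflat) = 0 ∧ lam (chromaticL col Lsharp Lflat) = 1) :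
    SprungSharpFlatMainConjecture W p col := by
  intro κ γ hκ hγ hγ' v hv g hg cneg c hc N hN f ϖ Lsharp Lflat hf hϖ hSP hcol D
  haveI := hN
  have hp3 : p = 3 := hX.1
  subst hp3
  have hp2 : (3 : ℕ) ≠ 2 := by decide
  have hgood : W.HasGoodReductionAtPrime 3 := hX.2.1.1
  have hdvd : ((3 : ℕ) : ℤ) ∣ W.frobeniusTrace 3 := hX.2.1.2
  -- Sprung 2012 Thm. 7.14: `X^•` finitely generated and `Λ`-torsion
  obtain ⟨hfinD, htorD⟩ :=
    h714 W 3 hp2 hgood hdvd f hf κ γ hκ hγ hγ' v hv g hg cneg c hc col Lsharp Lflat hSP hcol D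
  haveI := hfinD
  -- a generator of `char_Λ(X^•)` (`Λ` is a UFD)
  obtain ⟨gen, hgen⟩ := (charIdeal_isPrincipal_holds 3 D.X).principal
  have hchar : D.charIdeal = Ideal.span {gen} := hgen
  -- CONTROL: `rank E(ℚ) = 1` ⇒ `Sel_{3^∞}(E/ℚ)` infinite ⇒ `X^•/TX^•` infinite ⇒ `gen(0) = 0`
  have hrank : W.mordellWeilRank = 1 := (hGZK W (by omega)).1.trans h1
  have hSel : ¬ Finite (W.selmerGroupPInfty 3) := by
    intro hfin
    haveI := hfin
    haveI : Finite W.toAffine.Point := W.finite_point_of_finite_selmerGroupPInfty 3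
    have h0 : W.mordellWeilRank = 0 := W.mordellWeilRank_eq_zero_iff_finite.mpr ‹_›
    omega
  have hgen0 : PowerSeries.constantCoeff gen = 0 := by
    by_contra h0
    refine hSel (hctrl W 3 hp2 hsst hgood hdvd κ γ hκ hγ hγ' v hv g hg cneg c hc col D ?_)
    exact IwasawaAlgebra.finite_coinvariants_of_constantCoeff_ne_zero 3 D.X htorD gen
      (by rw [show Module.charIdeal (IwasawaAlgebra 3) D.X = D.charIdeal from rfl, hchar]
          exact Ideal.mem_span_singleton_self gen) h0
  have hXdvd : (PowerSeries.X : IwasawaAlgebra 3) ∣ gen := PowerSeries.X_dvd_iff.mpr hgen0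
  -- KATO (`n = 0` under `3`-adic surjectivity): `gen ∣ L^•`
  have hsurj : ∀ n : ℕ, W.HasSurjectiveModNGaloisRep (3 ^ n : ℕ) :=
    surjective_pow_of_surj_of_good W 3 hL20 hp2 hgood hs
  have hKato : gen ∣ chromaticL col Lsharp Lflat :=
    h716.dvd_of_charIdeal_eq_span hp2 hgood hdvd hf hκ hγ hγ' hv hg hc hSP hcol D htorD hsurj hchar
  -- SQUEEZE with the certificate `(μ, λ)(L^•) = (0, 1)`
  obtain ⟨hμ, hlam⟩ := hcert f hf Lsharp Lflat hSP
  have hspan : Ideal.span ({gen} : Set (IwasawaAlgebra 3)) =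
      Ideal.span {chromaticL col Lsharp Lflat} :=
    span_eq_span_of_dvd_of_X_dvd_of_lam_eq_one hKato hXdvd hμ hlam
  -- `ϖ` is a `3`-adic unit on X8
  have hϖ1 : ‖(ϖ : ℚ_[3])‖ = 1 := X8_norm_periodRatio_eq_one h3 W 3 hX hf hϖ
  obtain ⟨hspan', hι⟩ := span_C_units_mul_eq (PadicInt.mkUnits hϖ1) (chromaticL col Lsharp Lflat)
  refine ⟨htorD, PowerSeries.C ((PadicInt.mkUnits hϖ1 : ℤ_[3]ˣ) : ℤ_[3]) *
    chromaticL col Lsharp Lflat, ?_, ?_⟩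
  · rw [hchar, hspan, hspan']
  · rw [hι, PadicInt.mkUnits_eq]

/-- **K1's predicate at a rank-one pair**: on X8 ∧ Surj(3) ∧ `r_an = 1`, the certificate
`(μ, λ)(L^•_3(E)) = (0, 1)` gives `Theorems.SprungSharpFlatLowerDivisibility W 3 •` (the Eisenstein half,
`h = 1`, of the full Main Conjecture just proved; littype-11's edge). PER PAIR; closes nothing.
[cite: Sprung2012, Main Conj. 7.21 (p. 1505)] [cite: Sprung2024, §5.2 Lemma 5.6 (p. 41)] -/
theorem sprungSharpFlatLowerDivisibility_of_lam_eq_one_of_analyticRank_eq_one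
    (h714 : thm714_sharpFlatSelmerDual_finite_torsion)
    (h716 : thm716_sharpFlatCharIdeal_divisibility)
    (hctrl : lem56AllN_sharpFlat_finite_selmer_of_finite_coinvariants)
    (h3 : realPeriodRat_eq_unit_mul_plusPeriod_three)
    (hL20 : Wuthrich2014.lemma20_surjective_threeAdic_of_semistable)
    (hGZK : rank_eq_analyticRank_of_analyticRank_le_one)
    (W : WeierstrassCurve ℚ) [W.IsElliptic] [W.IsGloballyMinimal] (p : ℕ) [Fact p.Prime]
    (hX : ClassX8 W p) (hs : Surj W p) (h1 : W.analyticRank = 1) (col : Chroma)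
    (hcert : ∀ {N : ℕ} [NeZero N] (f : CuspForm (Gamma0 N) 2), IsNewformOf W f →
      ∀ Lsharp Lflat : IwasawaAlgebra p, IsSprungPair f p (W.frobeniusTrace p) Lsharp Lflat →
        mu (chromaticL col Lsharp Lflat) = 0 ∧ lam (chromaticL col Lsharp Lflat) = 1) :
    SprungSharpFlatLowerDivisibility W p col :=
  sprungSharpFlatLowerDivisibility_of_mainConjecture
    (sprungSharpFlatMainConjecture_of_lam_eq_one_of_analyticRank_eq_one h714 h716 hctrl h3 hL20 hGZK W
      p hX hs h1 col hcert)

/-! ### The certificate at the CONDUCTOR level, and its two Mazur–Tate readings -/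

/-- **The same with the certificate stated for ONE newform `f₀` of level `N_E` only.** The leaf
`SprungSharpFlatMainConjecture W p •` quantifies over newforms of `W` at ANY level `N`; by strong
multiplicity one across levels (`IsNewformOf.level_eq_conductorNorm_of_exists_conductorLevel`, tree
theorem: a newform of `W` at level `N_E` exists, so every newform of `W` has level `N_E`) and
`IsNewformOf.unique`, they are all `f₀`, so a certificate `hcert₀` for the Sprung pairs of `f₀` suffices
(the ♯/♭ twin of b2b's `kobayashiMainConjecture_of_cert_at_conductor_of_analyticRank_eq_one`). PER PAIR;
closes nothing. [cite: Sprung2012, Thm. 7.16 and Main Conj. 7.21 (pp. 1504–1505)]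
[cite: Sprung2024, §5.2 Lemma 5.6 (p. 41)] [cite: AtkinLehner1970, Thm. 4] [cite: GreenbergVatsal2000, p. 4] -/
theorem sprungSharpFlatMainConjecture_of_cert_at_conductor_of_analyticRank_eq_one
    (h714 : thm714_sharpFlatSelmerDual_finite_torsion)
    (h716 : thm716_sharpFlatCharIdeal_divisibility)
    (hctrl : lem56AllN_sharpFlat_finite_selmer_of_finite_coinvariants)
    (h3 : realPeriodRat_eq_unit_mul_plusPeriod_three)
    (hL20 : Wuthrich2014.lemma20_surjective_threeAdic_of_semistable)
    (hGZK : rank_eq_analyticRank_of_analyticRank_le_one)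
    (W : WeierstrassCurve ℚ) [W.IsElliptic] [W.IsGloballyMinimal] (p : ℕ) [Fact p.Prime]
    (hX : ClassX8 W p) (hs : Surj W p) (h1 : W.analyticRank = 1) (col : Chroma)
    [NeZero (W.conductorNorm ℤ)] {f₀ : CuspForm (Gamma0 (W.conductorNorm ℤ)) 2} (hf₀ : IsNewformOf W f₀)
    (hcert₀ : ∀ Lsharp Lflat : IwasawaAlgebra p, IsSprungPair f₀ p (W.frobeniusTrace p) Lsharp Lflat →
      mu (chromaticL col Lsharp Lflat) = 0 ∧ lam (chromaticL col Lsharp Lflat) = 1) :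
    SprungSharpFlatMainConjecture W p col := by
  refine sprungSharpFlatMainConjecture_of_lam_eq_one_of_analyticRank_eq_one h714 h716 hctrl h3 hL20
    hGZK W p hX hs h1 col ?_
  intro N _ f hf Lsharp Lflat hSP
  -- every newform of `W` lives at level `N_E` and is `f₀`
  have hN : N = W.conductorNorm ℤ := IsNewformOf.level_eq_conductorNorm_of_exists_conductorLevel ⟨f₀, hf₀⟩ hf
  subst hN
  have hff : f = f₀ := hf.unique hf₀
  subst hff
  exact hcert₀ Lsharp Lflat hSP

/-- **X8 ∧ Surj(3) ∧ `r_an = 1`, colour ♯: Sprung's Main Conjecture 7.21 for `L♯_3(E)` on the REAL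
`X^♯(E/ℚ_∞)` from ONE odd-level Mazur–Tate certificate** — for the newform `f₀` of level `N_E`, a
non-zero `Θ ∈ Λ` with `ι Θ = θ_n(f₀)`, `n` odd, `μ(Θ) = 0`, `λ(Θ) = deg ω_n^+ + 1 < 3ⁿ`
(`lam_sharp_eq_of_mazurTate`: then `(μ, λ)(L♯) = (0, 1)` for every Sprung pair of `f₀`); control and
Kato BY NAME as above. The REAL-currency form of `X8.span_eq_span_sharp_of_mazurTate_of_analyticRank_eq_one`
with its `hC` / `hKato` binders discharged. PER PAIR; the `Θ`-row is displayed (the cell's two-engine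
Mazur–Tate certificates, `MazurTateRecordsBWX8RankOne*`); closes nothing.
[cite: Sprung2012, Thm. 7.16 and Main Conj. 7.21 (pp. 1504–1505)] [cite: Pollack2003, Prop. 6.9 and Prop. 6.10]
[cite: Sprung2017, §3, Cor. 3.6 and Thm. 1.12] [cite: Sprung2024, §5.2 Lemma 5.6 (p. 41)]
[cite: Wuthrich2014, Lemma 20 (p. 399)] -/
theorem sprungSharpFlatMainConjecture_sharp_of_mazurTate_of_analyticRank_eq_one
    (h714 : thm714_sharpFlatSelmerDual_finite_torsion)
    (h716 : thm716_sharpFlatCharIdeal_divisibility)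
    (hctrl : lem56AllN_sharpFlat_finite_selmer_of_finite_coinvariants)
    (h3 : realPeriodRat_eq_unit_mul_plusPeriod_three)
    (hL20 : Wuthrich2014.lemma20_surjective_threeAdic_of_semistable)
    (hGZK : rank_eq_analyticRank_of_analyticRank_le_one)
    (W : WeierstrassCurve ℚ) [W.IsElliptic] [W.IsGloballyMinimal] (p : ℕ) [Fact p.Prime]
    (hX : ClassX8 W p) (hs : Surj W p) (h1 : W.analyticRank = 1)
    [NeZero (W.conductorNorm ℤ)] {f₀ : CuspForm (Gamma0 (W.conductorNorm ℤ)) 2} (hf₀ : IsNewformOf W f₀)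
    {n : ℕ} (hn : Odd n) {Θ : IwasawaAlgebra p}
    (hΘ : iwasawaToPowerSeries p Θ =
      ((mazurTateElement f₀ p n).map (algebraMap ℚ ℚ_[p]) : PowerSeries ℚ_[p]))
    (hΘ0 : Θ ≠ 0) (hμ : mu Θ = 0) (hlam : lam Θ = (cyclotomicOmegaPlus p n).natDegree + 1)
    (hlt : lam Θ < p ^ n) :
    SprungSharpFlatMainConjecture W p .sharp := by
  have hp2 : p ≠ 2 := by have := hX.1; omega
  have hgood : W.HasGoodReductionAtPrime p := by obtain ⟨hp3, hss, -⟩ := hX; subst hp3; exact hss.1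
  have hap : (p : ℤ) ∣ W.frobeniusTrace p := by obtain ⟨hp3, hss, -⟩ := hX; subst hp3; exact hss.2
  exact sprungSharpFlatMainConjecture_of_cert_at_conductor_of_analyticRank_eq_one h714 h716 hctrl h3
    hL20 hGZK W p hX hs h1 .sharp hf₀ fun Lsharp Lflat hSP ↦ by
      simpa only [chromaticL_sharp] using
        lam_sharp_eq_of_mazurTate hp2 hf₀ hgood hap hSP hn hΘ hΘ0 hμ hlam hlt

/-- **X8 ∧ Surj(3) ∧ `r_an = 1`, colour ♭: Sprung's Main Conjecture 7.21 for `L♭_3(E)` on the REAL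
`X^♭(E/ℚ_∞)` from ONE even-level Mazur–Tate certificate** (`n` even, `λ(Θ) = deg ω_n^- + 1 < 3ⁿ`,
`lam_flat_eq_of_mazurTate`). PER PAIR; closes nothing.
[cite: Sprung2012, Thm. 7.16 and Main Conj. 7.21 (pp. 1504–1505)] [cite: Pollack2003, Prop. 6.9 and Prop. 6.10]
[cite: Sprung2017, §3, Cor. 3.6 and Thm. 1.12] [cite: Sprung2024, §5.2 Lemma 5.6 (p. 41)]
[cite: Wuthrich2014, Lemma 20 (p. 399)] -/
theorem sprungSharpFlatMainConjecture_flat_of_mazurTate_of_analyticRank_eq_one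
    (h714 : thm714_sharpFlatSelmerDual_finite_torsion)
    (h716 : thm716_sharpFlatCharIdeal_divisibility)
    (hctrl : lem56AllN_sharpFlat_finite_selmer_of_finite_coinvariants)
    (h3 : realPeriodRat_eq_unit_mul_plusPeriod_three)
    (hL20 : Wuthrich2014.lemma20_surjective_threeAdic_of_semistable)
    (hGZK : rank_eq_analyticRank_of_analyticRank_le_one)
    (W : WeierstrassCurve ℚ) [W.IsElliptic] [W.IsGloballyMinimal] (p : ℕ) [Fact p.Prime]
    (hX : ClassX8 W p) (hs : Surj W p) (h1 : W.analyticRank = 1)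
    [NeZero (W.conductorNorm ℤ)] {f₀ : CuspForm (Gamma0 (W.conductorNorm ℤ)) 2} (hf₀ : IsNewformOf W f₀)
    {n : ℕ} (hn : Even n) {Θ : IwasawaAlgebra p}
    (hΘ : iwasawaToPowerSeries p Θ =
      ((mazurTateElement f₀ p n).map (algebraMap ℚ ℚ_[p]) : PowerSeries ℚ_[p]))
    (hΘ0 : Θ ≠ 0) (hμ : mu Θ = 0) (hlam : lam Θ = (cyclotomicOmegaMinus p n).natDegree + 1)
    (hlt : lam Θ < p ^ n) :
    SprungSharpFlatMainConjecture W p .flat := by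
  have hp2 : p ≠ 2 := by have := hX.1; omega
  have hgood : W.HasGoodReductionAtPrime p := by obtain ⟨hp3, hss, -⟩ := hX; subst hp3; exact hss.1
  have hap : (p : ℤ) ∣ W.frobeniusTrace p := by obtain ⟨hp3, hss, -⟩ := hX; subst hp3; exact hss.2
  exact sprungSharpFlatMainConjecture_of_cert_at_conductor_of_analyticRank_eq_one h714 h716 hctrl h3
    hL20 hGZK W p hX hs h1 .flat hf₀ fun Lsharp Lflat hSP ↦ by
      simpa only [chromaticL_flat] using
        lam_flat_eq_of_mazurTate hp2 hf₀ hgood hap hSP hn hΘ hΘ0 hμ hlam hlt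

end Summit.BirchSwinnertonDyer.BirchSwinnertonDyer.Theorems.K1RankOne

end
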